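import Mathlib.Analysis.SpecificLimits.Basic
import Mathlib.Algebra.Field.GeomSum
import HarnessLib

/-!
# The affine (contraction-with-floor) recursion bound: `Y_{k+1} ≤ κ Y_k + b ⇒ Y_k ≤ κᵏ Y₀ + b Σ_{j<k} κʲ ≤ κᵏ Y₀ + b/(1−κ)`

Topic `Literature/Analysis/Asymptotics`.  The bookkeeping behind every «decay at a fixed ratio with an
additive floor» iteration of regularity theory — Campanato / Morrey iterations, the geometric step in
every proof of Caffarelli–Kohn–Nirenberg's Proposition 2 (Robinson–Rodrigo–Sadowski 2016, Exercise 16.2,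
there with `κ = 1/2`: the tree's `Literature.Analysis.FluidPDE.CKN1982.iterate_half_le` /
`seq_iterate_half_le`), and the reading of any claimed «universal contraction `F(θr) ≤ κF(r) + C θ³`»
(iterating gives `limsup_k F(θᵏ r) ≤ Cθ³/(1 − κ)` — a FLOOR, not decay to `0`): here for a GENERAL ratio
`κ`, once for real sequences and once for `[0, ∞]`-valued scale functions `φ(γᵏ ρ₀)`.

* `seq_affine_iterate_le` — `Y (k) ≤ κ^k Y 0 + b Σ_{j<k} κ^j` for `κ ≥ 0` (real sequences);
* `seq_affine_iterate_le_floor` — `… ≤ κ^k Y 0 + b/(1−κ)` for `0 ≤ κ < 1`, `b ≥ 0`;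
* `scale_affine_iterate_le` / `scale_affine_iterate_le_floor` — the same for `φ : ℝ → ℝ≥0∞` along the
  scales `γᵏ ρ₀` under `φ(γρ) ≤ κ φ(ρ) + b` on `(0, ρ₀]`, floor `b (1 − κ)⁻¹`.

Theorems only (Mathlib algebra: `Finset.sum_range_succ'`, `geom_sum_eq`, `ENNReal.tsum_geometric`); no
definitions, no named facts.

## References
* [RobinsonRodrigoSadowski2016] J. C. Robinson, J. L. Rodrigo, W. Sadowski, *The Three-Dimensional
  Navier–Stokes Equations*, CUP 2016 — Exercise 16.2 (the iteration `φ(γρ) ≤ φ(ρ)/2 + b`) and the proof of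
  Thm. 16.1, (16.15)–(16.20).
-/

noncomputable section

open Finset Filter
open scoped BigOperators ENNReal Topology

namespace Literature.Analysis.Asymptotics

/-! ### Real sequences -/

/-- **Affine recursion, finite-sum form**: if `Y_{j+1} ≤ κ Y_j + b` for all `j`, with `κ ≥ 0`, then
`Y_k ≤ κᵏ Y_0 + b Σ_{j<k} κʲ`. (General-ratio form of the `κ = 1/2` step of
Robinson–Rodrigo–Sadowski 2016, Exercise 16.2.) [cite: RobinsonRodrigoSadowski2016, Exercise 16.2] -/
theorem seq_affine_iterate_le {Y : ℕ → ℝ} {κ b : ℝ} (hκ : 0 ≤ κ)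
    (h : ∀ j, Y (j + 1) ≤ κ * Y j + b) (k : ℕ) :
    Y k ≤ κ ^ k * Y 0 + b * ∑ j ∈ range k, κ ^ j := by
  induction k with
  | zero => simp
  | succ k ih =>
    have hsum : κ * ∑ j ∈ range k, κ ^ j = ∑ j ∈ range k, κ ^ (j + 1) := by
      rw [mul_sum]
      exact sum_congr rfl fun j _ => by ring
    calc Y (k + 1) ≤ κ * Y k + b := h k
      _ ≤ κ * (κ ^ k * Y 0 + b * ∑ j ∈ range k, κ ^ j) + b := by gcongr
      _ = κ ^ (k + 1) * Y 0 + b * ∑ j ∈ range (k + 1), κ ^ j := by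
          rw [sum_range_succ', pow_zero, ← hsum]
          ring

/-- **Affine recursion with floor**: if `Y_{j+1} ≤ κ Y_j + b` with `0 ≤ κ < 1` and `b ≥ 0`, then
`Y_k ≤ κᵏ Y_0 + b/(1 − κ)` for every `k` — the iterates contract to the FLOOR `b/(1−κ)`, not to `0`.
[cite: RobinsonRodrigoSadowski2016, Exercise 16.2; proof of Thm. 16.1 (16.15)–(16.20)] -/
theorem seq_affine_iterate_le_floor {Y : ℕ → ℝ} {κ b : ℝ} (hκ : 0 ≤ κ) (hκ1 : κ < 1) (hb : 0 ≤ b)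
    (h : ∀ j, Y (j + 1) ≤ κ * Y j + b) (k : ℕ) :
    Y k ≤ κ ^ k * Y 0 + b / (1 - κ) := by
  have hgeom : ∑ j ∈ range k, κ ^ j ≤ 1 / (1 - κ) := by
    rw [geom_sum_eq hκ1.ne k]
    have h1 : 0 < 1 - κ := by linarith
    have hk : 0 ≤ κ ^ k := pow_nonneg hκ k
    have heq : (κ ^ k - 1) / (κ - 1) = (1 - κ ^ k) / (1 - κ) := by
      rw [← neg_sub 1 (κ ^ k), ← neg_sub 1 κ, neg_div_neg_eq]
    rw [heq]
    gcongr
    linarith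
  calc Y k ≤ κ ^ k * Y 0 + b * ∑ j ∈ range k, κ ^ j := seq_affine_iterate_le hκ h k
    _ ≤ κ ^ k * Y 0 + b * (1 / (1 - κ)) := by gcongr
    _ = κ ^ k * Y 0 + b / (1 - κ) := by ring

/-! ### Scale functions with values in `[0, ∞]` -/

/-- **Affine recursion along geometric scales, finite-sum form** (`[0, ∞]`-valued): if
`φ(γρ) ≤ κ φ(ρ) + b` for all `ρ ∈ (0, ρ₀]` (`0 < γ ≤ 1`), then
`φ(γᵏ ρ₀) ≤ κᵏ φ(ρ₀) + b Σ_{j<k} κʲ`. (General-ratio twin of the tree's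
`Literature.Analysis.FluidPDE.CKN1982.iterate_half_le`.) [cite: RobinsonRodrigoSadowski2016, Exercise 16.2] -/
theorem scale_affine_iterate_le {φ : ℝ → ℝ≥0∞} {κ b : ℝ≥0∞} {γ ρ₀ : ℝ} (hγ : 0 < γ) (hγ1 : γ ≤ 1)
    (hρ₀ : 0 < ρ₀) (h : ∀ ρ, 0 < ρ → ρ ≤ ρ₀ → φ (γ * ρ) ≤ κ * φ ρ + b) (k : ℕ) :
    φ (γ ^ k * ρ₀) ≤ κ ^ k * φ ρ₀ + b * ∑ j ∈ range k, κ ^ j := by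
  induction k with
  | zero => simp
  | succ k ih =>
    have hk0 : 0 < γ ^ k * ρ₀ := by positivity
    have hk1 : γ ^ k * ρ₀ ≤ ρ₀ := by
      have : γ ^ k ≤ 1 := pow_le_one₀ hγ.le hγ1
      nlinarith
    have hstep := h (γ ^ k * ρ₀) hk0 hk1
    rw [← mul_assoc, ← pow_succ'] at hstep
    have hsum : κ * ∑ j ∈ range k, κ ^ j = ∑ j ∈ range k, κ ^ (j + 1) := by
      rw [mul_sum]
      exact sum_congr rfl fun j _ => by ring
    calc φ (γ ^ (k + 1) * ρ₀) ≤ κ * φ (γ ^ k * ρ₀) + b := hstep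
      _ ≤ κ * (κ ^ k * φ ρ₀ + b * ∑ j ∈ range k, κ ^ j) + b := by gcongr
      _ = κ ^ (k + 1) * φ ρ₀ + b * ∑ j ∈ range (k + 1), κ ^ j := by
          rw [sum_range_succ', pow_zero, ← hsum]
          ring

/-- **Affine recursion along geometric scales, with floor** (`[0, ∞]`-valued): under
`φ(γρ) ≤ κ φ(ρ) + b` on `(0, ρ₀]` with `κ < 1`, `φ(γᵏ ρ₀) ≤ κᵏ φ(ρ₀) + b (1 − κ)⁻¹` for every `k`.
[cite: RobinsonRodrigoSadowski2016, Exercise 16.2; proof of Thm. 16.1 (16.15)–(16.20)] -/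
theorem scale_affine_iterate_le_floor {φ : ℝ → ℝ≥0∞} {κ b : ℝ≥0∞} {γ ρ₀ : ℝ} (hγ : 0 < γ)
    (hγ1 : γ ≤ 1) (hρ₀ : 0 < ρ₀) (hκ1 : κ < 1)
    (h : ∀ ρ, 0 < ρ → ρ ≤ ρ₀ → φ (γ * ρ) ≤ κ * φ ρ + b) (k : ℕ) :
    φ (γ ^ k * ρ₀) ≤ κ ^ k * φ ρ₀ + b * (1 - κ)⁻¹ := by
  have hgeom : ∑ j ∈ range k, κ ^ j ≤ (1 - κ)⁻¹ := by
    calc ∑ j ∈ range k, κ ^ j ≤ ∑' j, κ ^ j := ENNReal.sum_le_tsum _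
      _ = (1 - κ)⁻¹ := ENNReal.tsum_geometric κ
  have _ := hκ1
  calc φ (γ ^ k * ρ₀) ≤ κ ^ k * φ ρ₀ + b * ∑ j ∈ range k, κ ^ j :=
        scale_affine_iterate_le hγ hγ1 hρ₀ h k
    _ ≤ κ ^ k * φ ρ₀ + b * (1 - κ)⁻¹ := by gcongr

end Literature.Analysis.Asymptotics

end
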